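import Mathlib
import HarnessLib
import HarnessLib.Audit
import Summits.CriticalPhenomena.Statement
import Literature.Probability.RandomPlanarGeometry.SLEConvergenceCriterion
import Literature.Probability.RandomPlanarGeometry.LoewnerDescription
import Literature.Probability.RandomPlanarGeometry.SLEUniquenessInLaw
import Literature.Probability.RandomPlanarGeometry.ChordalBoundary
import Literature.Probability.RandomPlanarGeometry.ConformalMapCaratheodoryProofs
import Literature.Probability.RandomPlanarGeometry.SelfAvoidingWalkProofs
import HarnessLib.Audit.Status.Attr

/-!
Route: SAWLaplacianWalk

# Route SAWLaplacianWalk — the critical SAW is a lattice Laplacian-5/8 walk — target tilt = (SRW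
slit harmonic ratio)^(5/8), far-field b(2b+1) gives kappa = 8/3

It suffices to show X = K58 ∧ P ∧ I ∧ R ∧ T, realising card laplacian-five-eighths-walk ("the
critical SAW is a Laplacian-b walk with b = 5/8 in disguise") in the form that assembles. Notation:
for a lattice past η (a SAW prefix from a_δ with tip w) and a lattice target c, Z_η(c) := Σ_{SAW ω:
w→c in Ω_δ avoiding η} x_c^{|ω|} and H_η(c) := P[simple random walk from w on Ω_δ, killed on η and
on leaving Ω_δ, first hits c] = Σ_{paths} 4^{-|ω|}. Lawler's Laplacian-b motion aimed at d instead
of b is the one aimed at b tilted by (harmonic-measure ratio)^b; for the SAW the tilt is EXACTLY M_η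
= Z_η(d_δ)/Z_η(b_δ) (Radon–Nikodym density of "aim at d" w.r.t. "aim at b" on the past, an exact
positive martingale by first-step decomposition).
 (K58) TipHarmonicLaw — the LATTICE Laplacian-5/8 law: under SAW.law, with probability → 1 and one
constant C_δ, simultaneously for all prefixes η before the walk comes ρ-close to b or d₀: log M_η =
C_δ + (5/8)·log(H_η(d_δ)/H_η(b_δ)) ± ε.
 (P) HarmonicPassage — K58 ⇒ for every subsequential limit ν the localised processes N^x_t =
[g_t′(x)/(g_t(x) − W_t)²]^{5/8} (x = half-plane image of d₀ under a chordal uniformizer) satisfy the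
martingale cylinder identity under ν (discrete potential theory at the tip + passage of the exact
martingale).
 (I) HarmonicIdentification — a Loewner-describable random curve from a whose N^x are martingales
for an unbounded set of x is chordal SLE_{8/3}: x^{2b} N^x_t = 1 + 2b W_t/x + b(2b+1)(W_t² −
6t/(2b+1))/x² + O(x^{-3}), so W and W² − (8/3)t are local martingales (b = 5/8 ⇔ κ = 6/(2b+1) = 8/3,
Lawler's formula read off the far field), then Lévy and the tree's
`isSLELaw_of_isLocalMartingale_driving`.
 (R) LimitsDescribable — every probability subsequential limit of the SAW curve laws is carried by
curves from a that are Loewner-describable through every chordal uniformizing map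
(Kemppainen–Smirnov Thm 1.5 (ii) / Cor 1.7 output form).
 (T) EventualTight — tightness along the mesh (`IsTightAlongMesh`, eventual in δ; the item is SHARED
verbatim with SAWLeftRightFKG.EventualTight, stmt-CriticalPhenomena-1881; NOT the refuted all-δ
`Tight` of stmt-CriticalPhenomena-0772).
Lean: `TipHarmonicLaw ∧ HarmonicPassage ∧ HarmonicIdentification ∧ LimitsDescribable ∧
EventualTight` (decls of this route file, each the one-line term of § Cruxes, elaborated in
Sketch.lean; assembly `BoundaryApprox → TipHarmonicLaw → HarmonicPassage → HarmonicIdentification →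
LimitsDescribable → EventualTight → SAWScalingLimit`)

## Assembly
Fix (D; a, b) and an endpoint approximation. EventualTight gives tightness along the mesh; by the
tree's criterion (`convergesInLawToSLE_of_isTightAlongMesh'` with `IsSLECurve.map_eq_holds`; the SAW
laws are probability measures only for small δ (`IsEndpointApprox.reachable`; at large δ the walk
type may be empty), so the criterion's Prokhorov/subsequence proof is re-run along mesh sequences
s_n → 0⁺ rather than invoked with its all-δ instance hypothesis; a.e.-measurability is trivial on
the discrete σ-algebra) it remains to identify every probability subsequential limit ν. Take φ
chordal uniformizing (`MarkedDomain.exists_isChordalUniformizing_holds`); LimitsDescribable gives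
a.e. describability and source = a; for x > 0, d₀ := φ.boundaryExtension x is a boundary point ≠ a,
b (Carathéodory, `ChordalBoundary.boundaryExtension_ofReal_mem_frontier`), BoundaryApprox gives d_δ,
HarmonicPassage (fed TipHarmonicLaw) gives the cylinder identities for this x; so T := {x > 0} works
and HarmonicIdentification yields `IsSLELaw (8/3) D ν`.

Rationale: WHY THIS LINE. Lawler's Laplacian-b family (Lawler2006: kernel ∝ H^b, LM_b = SLE_{6/(2b+1)}, a
theorem at b = 1 = loop-erased walk, Lawler1987 / MadrasSlade1993 §10.2; b = 0 = the growing SAW /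
percolation exploration with κ = 6, Lawler2005ConformallyInvariant §0.4) is a one-parameter bridge
from a THEOREM (LERW → SLE₂: LawlerSchrammWerner2004, YadinYehudayoff2011) to the conjunct, and b =
5/8 is the SAW boundary exponent (restriction exponent of LawlerSchrammWerner2003;
KennedyLawler2013: boundary partition functions ≈ lattice factor × H^{5/8}). The route makes "SAW =
LM_{5/8}" precise at the one place where the SAW IS a consistent growth process — its own exact
target-switching density (Lawler2005ConformallyInvariant §0.3, transitions q* = ratios of SAW masses
avoiding the whole past) — and compares it with the random walk's harmonic measure IN THE SAME SLIT
GRAPH, so that (i) the whole 5/8-content becomes a pure lattice statement K58 about two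
combinatorial sums (x_c-weighted SAW counts vs 4^{-n}-weighted SRW path sums: no conformal map, no
phase, no observable ansatz; testable by transfer matrices), and (ii) ALL conformal geometry is
pushed into a random-walk statement (P), where discrete potential theory exists (KozdronLawler2005,
Chelkak2016, YadinYehudayoff2011). Identification (I) re-uses the tree's CDHKS machinery
(CDHKSCRAS2014; the `isSLELaw_three_of_spinCylinderIdentity` pattern with Lévy's characterisation
and the κ ≠ 8 trace theorem already proved) with the spin observable replaced by the harmonic
5/8-observable, and the far-field coefficient b(2b+1)(W² − 6t/(2b+1)) is exactly where κ = 6/(2b+1)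
comes from. Imported areas: discrete potential theory / random-walk Poisson kernels and boundary
Harnack (probability), Loewner–Itô martingale identification (stochastic analysis), with the
physical dictionary Laplacian growth (dielectric-breakdown exponent η = b) ↦ SLE_{6/(2b+1)}. Versus
existing routes and negatives: SAWParafermion needs a ℤ² parafermionic observable with no known
structure, SAWConfRestriction / SAWRestrictionRigidity need covariance or restriction OF THE LIMIT,
SAWHexUniversality / SAWQuantumGravity need a second model; here the only limit object is harmonic
measure and tightness is asked only eventually in δ; versus the sibling card
target-switching-martingale-five-eighths (variant, unrouted) the lattice harmonic measure is
inserted between its martingale M_n and its continuum functional, splitting its single crux into K58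
(lattice vs lattice) + P (SRW vs continuum).

RANKED CRUXES. #2 TipHarmonicLaw (crux) — (K58, the card's conjecture K in two-target integrated
form) for every Dobrushin domain (Ω; a, b), endpoint approximation (a_δ, b_δ), third boundary point
d₀ ∉ {a, b} with lattice approximations d_δ → d₀ joined to a_δ, and every ρ, ε > 0: for all small δ
there is a constant C such that, with SAW.law-probability ≥ 1 − ε, EVERY prefix η = γ[0, n] whose
vertices stay at distance ≥ ρ from b and d₀ and from whose tip d_δ is still reachable satisfies
|log(Z_η(d_δ)/Z_η(b_δ)) − (5/8)·log(H_η(d_δ)/H_η(b_δ)) − C| ≤ ε. [difficulty: open-problem] (why it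
might fail: Needs the tip's lattice factor to be target-blind to o(1) and residual lattice
corrections to factor through b_δ, d_δ; pinches of the past against ∂Ω between b and d with
non-vanishing probability, or an anomalous tip correction, break it; the worst-case-in-η form IS
false (strip eigenvalues).) [Lawler2006, KennedyLawler2013, LawlerSchrammWerner2003,
Lawler2005ConformallyInvariant]
#3 LimitsDescribable (crux) — (Kemppainen–Smirnov regularity for the SAW) for every Dobrushin
domain, endpoint approximation and chordal uniformizing map φ, every probability subsequential limit
law ν of the SAW curve laws (`IsSubseqLimitLaw`) is carried by curve classes that start at a and are
Loewner-describable through φ (`IsLoewnerDescribable`: capacity-parametrised pull-back generated by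
a curve with continuous driving function) — KS17 Thm 1.5 (ii) / Cor 1.7 in output form, the
hypothesis shape of HarmonicPassage / HarmonicIdentification. [difficulty: open-problem] (why it
might fail: Its only known engine is Condition G2 (uniform unforced-annulus-crossing bound over all
conditionings), for which no SAW technology exists (KS17 §4: FK, percolation, harmonic explorer,
LERW; G2 even FAILS for UST §4.5); limits could a priori have boundary-creeping pieces not generated
by a curve.) [KemppainenSmirnov2017, DuminilCopinHammond2013, arXiv:2310.17299,
LawlerSchrammWerner2004SAW]
#4 HarmonicPassage (crux) — TipHarmonicLaw ⇒ for every (Ω; a, b), endpoint approximation, third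
point d₀ with approximations d_δ, chordal uniformizing map φ with boundary value d₀ at the real
point x, and every probability subsequential limit ν of the SAW curve laws that is carried by
Loewner-describable curves from a: for all levels m and times s ≤ t, E_ν[(N^{x,m}_t −
N^{x,m}_s)·ψ(W_{s₁}, …, W_{sₙ})] = 0 for continuous |ψ| ≤ 1 and sᵢ ≤ s, where W = drivingFunction φ,
N^x_t = exp(−(5/4)∫₀ᵗ du/(g_u(x) − W_u)²)·|g_t(x) − W_t|^{−5/4} (= [g_t′(x)/(g_t(x) − W_t)²]^{5/8})
and N^{x,m} is N^x stopped when |g(x) − W| ≤ 1/(m+1) or at time m+1. [deps: TipHarmonicLaw]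
[difficulty: XL] (why it might fail: Needs SRW hitting ratios AT THE TIP of a rough lattice slit to
converge to the continuum tip kernel uniformly along SAW pasts (boundary Harnack at a fractal tip;
leakage through width-δ channels) plus uniform integrability of the density martingale; either may
fail on atypical pasts.) [KozdronLawler2005, Chelkak2016, YadinYehudayoff2011,
LawlerSchrammWerner2004, CDHKSCRAS2014]
#5 HarmonicIdentification (crux) — let φ be a chordal uniformizing map of (D; a, b), ν a probability
law on curve classes, ν-a.e. Loewner-describable through φ and starting at a; if for an unbounded
(above or below) set T of reals x the stopped harmonic 5/8-observables N^{x,m} of W =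
drivingFunction φ satisfy the cylinder identity for all m, s ≤ t, ψ, then ν is the chordal SLE_{8/3}
law (`IsSLELaw (8/3) D ν`). Proof route: monotone class ⇒ N^{x,m} bounded martingales; far-field
stopping of W; x^{5/4}N^x_t = 1 + (5/4)W_t/x + (45/32)(W_t² − (8/3)t)/x² + O(x^{−3}) ⇒ W and W² −
(8/3)t continuous local martingales ⇒ Lévy ⇒ `isSLELaw_of_isLocalMartingale_driving`. [difficulty:
L] (why it might fail: As typed, c ↦ N^{x,m}_t(c) must be measurable/integrable (else the Bochner
junk value 0 makes the hypothesis vacuous and the statement false); a one-sided far field (|x| → ∞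
along T) has to suffice; W 0 = 0 must be derived from source = a and boundary injectivity.)
[CDHKSCRAS2014, LawlerSchrammWerner2003, Lawler2006, arXiv:math/0505368]
#6 EventualTight (crux) — (shared item, identical signature to SAWLeftRightFKG.EventualTight =
stmt-CriticalPhenomena-1881) for every Dobrushin domain and endpoint approximation the SAW curve
laws are tight along δ → 0⁺: for every ε some compact set of CurveClass ℂ carries all but ε of the
mass for all small δ (`IsTightAlongMesh`, the form `convergesInLawToSLE_of_isTightAlongMesh`
consumes; the repair of the refuted all-δ Tight). [difficulty: open-problem] (why it might fail: No
annulus-crossing / traversal bound for the critical SAW is in print (Aizenman–Burchard input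
missing; KS17 §4 omits SAW); sub-ballisticity (DuminilCopinHammond2013, arXiv:2310.17299) is the
strongest known input; boundary approach of the x_c-SAW is uncontrolled.) [KemppainenSmirnov2017,
DuminilCopinHammond2013, arXiv:2310.17299,
Summit.CriticalPhenomena.SAWScalingLimit.Theorems.SAWParafermionTight_refuted]
#9 SlitFirstStep (support) — first-step decomposition of the slit partition function: for a bounded
Ω, δ > 0, w ∈ S and w ≠ c, Z_{w,S}(c) = x_c · Σ_{u ∼ w, u ∉ S} Z_{u, u::S}(c) — the identity that
makes M_n = Z_η(d)/Z_η(b) an exact martingale (Lawler 2005, (0.1) with the harmonic q replaced by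
SAW masses q*). [difficulty: provable-now] [Lawler2005ConformallyInvariant, MadrasSlade1993]
#9 TipForgetsTarget (support) — (leading order of K58; "the polymer's next step does not know its
distant target") with SAW.law-probability → 1, simultaneously at all steps before coming ρ-close to
b or d₀, ONE lattice step changes log(Z_η(d_δ)/Z_η(b_δ)) by at most ε — equivalently the one-step
kernels of the SAW aimed at b and aimed at d agree up to e^{±ε}; implied by TipHarmonicLaw and
random-walk boundary Harnack, of independent interest (ratio mixing for the critical SAW).
[difficulty: open-problem] [Lawler2005ConformallyInvariant, KennedyLawler2013, Lawler2006]
#9 BoundaryApprox (support) — every boundary point d₀ of a Dobrushin domain with an endpoint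
approximation admits lattice approximations d_δ → d₀ joined to a_δ in Ω_δ for all small δ (the
largest component of δℤ² ∩ Ω exhausts Ω); supplies the unbounded set of third marked points x =
φ⁻¹(d₀) that the assembly feeds to HarmonicIdentification. [difficulty: M] [ChelkakSmirnov2012,
DuminilCopinSmirnov2012]

TWO-LAYER PLAN. Foreseen glued splits (k ≤ 3, depth 1), to be filed only after a crux closes or is
released with a census: TipHarmonicLaw ⇐ TipFactorisation (Z_η(c) = λ(η)·F(η, c)(1 + o(1)) with λ
target-blind — ratio mixing, cf. TipForgetsTarget) → FarFieldFiveEighths (F(η, d)/F(η, b) =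
C·(H-ratio)^{5/8}, the restriction-exponent content) → TipHarmonicLaw; HarmonicPassage ⇐
TipKernelConvergence (discrete → continuum Martin-kernel ratios at the tip, uniformly along typical
pasts) → DensityLocalisation (uniform integrability + stopping of M_n, passage of the exact
martingale property to cylinder identities) → HarmonicPassage; LimitsDescribable and EventualTight ⇐
one eventual-δ Condition-G2 statement for SAW laws (Kemppainen–Smirnov §2.1.3, annuli above mesh
scale) → KS Thm 1.5/Cor 1.7 → both (EventualTight also ⇐ SAWLeftRightFKG's SAWTraversalBound via the
proved Aizenman–Burchard criterion).

KILL CRITERIA. ¬TipHarmonicLaw in probability — e.g. a transfer-matrix or Kennedy-type computation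
showing that the fitted exponent of the exact tilt M against the lattice harmonic ratio settles away
from 5/8, or that M/N^{5/8} fluctuates by O(1) along typical paths — closes the route
`refuted:TipHarmonicLaw` and refutes the Laplacian-5/8 picture itself (informative either way).
¬EventualTight or ¬LimitsDescribable kills every SLE-identification route of the conjunct as typed
(shared cruxes; no pivot inside this line). ¬HarmonicIdentification as typed means a mis-typing
(measurability/localisation) ⇒ restate, not a pivot. If the sibling card
target-switching-martingale-five-eighths is routed and its TS crux is proved directly,
HarmonicPassage + TipHarmonicLaw are mooted ⇒ close `superseded`.

NOT DECOMPOSED YET. The kernel-level (one-step, sub-leading (δ/R)^{1/2}) form of the card's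
conjecture K and Lawler's universality conjecture U_b for Laplacian-b walks — neither is on the
assembly path; the b-homotopy (b = 1, where K58 is Lawler1987's identity "Laplacian walk = LERW", to
b = 5/8) is motivation, not an item. Also deferred: discrete potential theory at the tip (layer-2
child of HarmonicPassage), the eventual-G2 statement (common child of LimitsDescribable and
EventualTight), the probability-measure padding of SAW.law at non-small δ and the
boundary-correspondence glue (inside Assembly), the requested definitions (Z_η, H_η, the target-tilt
observable) as library notions, radial / whole-plane variants, and any use of the kernel form as a
proof tool.

CHEAPEST FALSIFIER. Exact evaluation of both sides of K58 in small boxes: Z_η and H_η are finite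
objects (H_η is one linear solve), so for Ω an L × L′ rectangle (L ≤ 12 by transfer matrix, ≤ 7 by
brute force), a_δ adjacent to a corner, b_δ, d_δ on the far sides and ALL pasts η with |η| ≤ 6,
compute M_η/M_∅ against (N_η/N_∅)^s and fit s. The card's N = 5, 6 enumeration gave 0.63–0.76
drifting down with N; a fit stabilising away from 0.625 as L grows (say 0.70 ± 0.02 at L = 8…12)
refutes TipHarmonicLaw cheaply, and Kennedy-style pivot sampling of x_c-SAWs in a 300δ disc,
recording log M along paths against the lattice Dirichlet solve, is the definitive version. Not run
here (compute-free hub; this is the refuter's first `kit compute` job).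

NUMBERS. b = 5/8 (SAW boundary one-leg = restriction exponent of SLE_{8/3}); κ(b) = 6/(2b+1): κ(1) =
2 (LERW, theorem), κ(5/8) = 8/3, κ(0) = 6 (growing SAW / percolation exploration); far-field
coefficient b(2b+1) = 45/32 at b = 5/8; x_c = 1/μ with 2.6 ≤ μ ≤ 2.7 (LawlerSchrammWerner2004SAW
§3.1); card's enumeration: fitted exponent 0.67–0.76 (N = 5), 0.65–0.75 (N = 6), LERW value 1. Items
at open: 9 (5 cruxes, 3 support, 1 assembly).

DEFINITION REQUESTS. (1) `SAW.slitWeight Ω δ w S c` — the x_c-mass of SAWs from w to c in Ω_δ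
avoiding the finite vertex set S (the Z of the signatures; API: first-step decomposition,
domain-Markov identity, finiteness), topic Literature/Probability/RandomPlanarGeometry; (2)
`srwSlitHitting Ω δ w S c` — first-hitting probability of c by simple random walk from w on Ω_δ
killed on S (the H; API: harmonic off S ∪ {c}, values in [0, 1], positive iff reachable), topic
Literature/Probability/RandomPlanarGeometry; (3) `Loewner.targetTilt b W x t` — the change-of-target
observable [g_t′(x)/(g_t(x) − W_t)²]^b for real x with its localisation times (Schramm–Wilson
coordinate change, SLE_κ(ρ) density), topic Literature/Probability/RandomPlanarGeometry. Filed after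
open with `--for` the consuming items; signatures then shrink by `set-signature`.

Novelty: Searches (2026-08-15): `lit vsearch` "Laplacian-b random walk … probability ∝ harmonic measure^b …
LERW b=1 … SAW 5/8" (10 docs: Lawler2005 book pp. 10–14, MadrasSlade1993 pp. 294–296 = §10.2
"Laplacian self-avoiding walk" ≡ LERW, Lawler1991 pp. 103–107; none compares the SAW kernel with
harmonic measure); `lit search --hybrid` "Poisson kernel random walk slit domain loop-erased
convergence tip" (Lawler2005, Lawler1991, Chen–Fukushima SKLE: potential theory only); `lit search
--source crossref` "Laplacian random walk self-avoiding SLE harmonic measure" (8: Lawler1987;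
HattoriOgoOtsuka2017 = a LERW↔SAW interpolation by loop-erasure order on the Sierpiński gasket, a
different one-parameter bridge; Gwynne–Miller 2021; Rieger 1988) and "Laplacian-b random walk
Schramm-Loewner Lawler" (Lawler2006 + Lawler surveys); zbMATH "Laplacian random walk Lyklema Evertsz
Pietronero" (0) and "self-avoiding walk Poisson kernel boundary 5/8 lattice correction" (0); `lit
frontier CriticalPhenomena --since 2020` (30 rows, only arXiv:2310.17299 sub-ballisticity concerns
SAW); `lit bridges CriticalPhenomena --cross any` (nothing on growth kernels); `lit galaxy search
"Laplacian random walk" --star all` (queue timeout) then `--star pdf` "Laplacian-b random walk" (5: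
arXiv:1112.4123 Drenning ERBM, math/0507276 Dubédat, 2006.07899 Shapira–Wiese LERW field theory,
2002.03359 Murayama — none on SAW kernels); OpenAlex/arXiv returned HTTP 429 at filing; Lawler2006
full text paywalled here (acq-01569; the  [refs: 2310.17299, 1112.4123, math/0505368, Lawler2005, MadrasSlade1993, Lawler1991, Lawler1987, HattoriOgoOtsuka2017, Lawler2006, KennedyLawler2013, LawlerSchrammWerner2003, CDHKSCRAS2014]

Barriers (technique_class: laplacian-random-walk harmonic-measure-martingale): - technique_class: laplacian-random-walk harmonic-measure-martingale
- Literature.Barriers.CriticalPhenomena.SAWNotKineticallyGrown: applies to SAW-as-kinetic-growth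
with LOCAL rules (uniform-n measures inconsistent by trapping; local rules ⇒ locality ⇒ κ = 6).
Evaded along its own `evasions_known`: the growth description used is the exact NON-local
conditional kernel of ONE consistent x_c-chordal measure (ratios of SAW masses avoiding the whole
past, Lawler 2005 §0.3 q*), and the comparison class (harmonic measure)^b with b = 5/8 ≠ 0 is
non-local; no uniform-n family is used.
- Literature.Barriers.CriticalPhenomena.NienhuisWeightsExcludeVertexSAW: no parafermionic observable
and no exact vertex relation is posited; the only exactly harmonic object is the SRW hitting
probability (discrete-harmonic off the slit by construction); the SAW enters through an asymptotic
law in probability (K58) — the barrier's permitted "statement about the limit" form. Honest residue: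
no engine for K58 beyond restriction heuristics and numerics.
- Literature.Barriers.CriticalPhenomena.ParafermionicHalfCauchyRiemann: not met — no
half-Cauchy–Riemann identity, no winding phase.
- Literature.Barriers.CriticalPhenomena.EmbeddingModulusUniqueness: the line is embedding-aware —
H_η is the harmonic measure of the honestly embedded slit graph (isotropic SRW ⇒ continuum Laplacian
in Passage); on a sheared lattice K58 would hold with the sheared walk's anisotropic harmonic
measure and Passage would output t

Novelty grade: variant — route-review (refuter), novelty read: the physical dictionary "growth kernel ∝ (harmonic measure)^η ⟷ SLE_κ, κ = 6/(2η+1)", with η = 5/8 ⟷ κ = 8/3 for the SAW, is published as such — Hastings, Phys. Rev. Lett. 88 (2002) 055506 (not cited in the route's NOVELTY section; found by `lit search "Laplacia (refuter refuter-rreview-route-CriticalPhenomena--f4cd4cf0-0, 2026-08-15T14:01:15Z; prior: doi:10.1103/physrevlett.88.055506 (Hastings 2002, Exact multifractal spectra for arbitrary Laplacian random walks: LRW_eta <-> SLE_{6/(2eta+1)}), Lawler2006 (Laplacian-b random walk and SLE_{6/(2b+1)}), LawlerSchrammWerner2003 (restriction exponent 5/8), KennedyLawler2013 (SAW boundary partition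 functions ~ lattice factor x H^{5/8}), Lawler2005ConformallyInvariant §0.3 (q* target-switching kernel))

sub-problem: SAWScalingLimit · status: open · opened planner-plancard-CriticalPhenomena-SAWScaling-fdf83c1c-0 2026-08-15T11:34:20Z · rev 3 · ledger route-CriticalPhenomena-SAWLaplacianWalk
GENERATED by the gate from the ledger (D-0016/17). Provers cite these decls: `theorem foo : Summit.CriticalPhenomena.SAWScalingLimit.Theses.SAWLaplacianWalk.<Decl> := …` in Summits/CriticalPhenomena/SAWScalingLimit/Theorems/<Name>.lean.
-/

namespace Summit.CriticalPhenomena.SAWScalingLimit.Theses.SAWLaplacianWalk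

open scoped BigOperators Topology Manifold Classical MeasureTheory ProbabilityTheory Matrix InnerProductSpace ComplexConjugate ContinuousMap
open Filter Set Function TopologicalSpace MeasureTheory

attribute [summit_statement] _root_.SAWScalingLimit

/-- item stmt-CriticalPhenomena-4480 · crux · rank 2 · open · by planner
why it might fail: Needs the tip's lattice factor to be target-blind to o(1) and residual lattice corrections to factor through b_δ, d_δ; pinches of the past against ∂Ω between b and d with non-vanishing probability, or an anomalous tip correction, break it; the worst-case-in-η form IS false (strip eigenvalues).
sources: Lawler2006, KennedyLawler2013, LawlerSchrammWerner2003, Lawler2005ConformallyInvariant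
[crux] (K58, the card's conjecture K in two-target integrated form) for every Dobrushin domain (Ω;
a, b), endpoint approximation (a_δ, b_δ), third boundary point d₀ ∉ {a, b} with lattice
approximations d_δ → d₀ joined to a_δ, and every ρ, ε > 0: for all small δ there is a constant C
such that, with SAW.law-probability ≥ 1 − ε, EVERY prefix η = γ[0, n] whose vertices stay at
distance ≥ ρ from b and d₀ and from whose tip d_δ is still reachable satisfies
|log(Z_η(d_δ)/Z_η(b_δ)) − (5/8)·log(H_η(d_δ)/H_η(b_δ)) − C| ≤ ε. [difficulty: open-problem] -/
@[route_item "route-CriticalPhenomena-SAWLaplacianWalk", crux]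
def TipHarmonicLaw : Prop :=
  ∀ (D : Literature.Probability.RandomPlanarGeometry.DobrushinDomain) (a b d : ℝ → Literature.Probability.LatticeModels.Site 2) (d₀ : ℂ), let Z : ℝ → Literature.Probability.LatticeModels.Site 2 → List (Literature.Probability.LatticeModels.Site 2) → Literature.Probability.LatticeModels.Site 2 → ℝ := fun δ w S c => ∑' ω : Literature.Probability.RandomPlanarGeometry.SAW.DomainSAW D.carrier δ w c, if ∀ v ∈ ω.walk.support.tail, v ∉ S then Literature.Probability.RandomPlanarGeometry.SAW.criticalFugacity ^ ω.length else 0; let H : ℝ → Literature.Probability.LatticeModels.Site 2 → List (Literature.Probability.LatticeModels.Site 2) → Literature.Probability.LatticeModels.Site 2 → ℝ := fun δ w S c => ∑' ω : (Literature.Probability.LatticeModels.discreteDomainGraph D.carrier δ).Walk w c, if (∀ v ∈ ω.support.tail, v ∉ S) ∧ c ∉ ω.support.dropLast then (1 / 4 : ℝ) ^ ω.length else 0; Literature.Probability.RandomPlanarGeometry.SAW.IsEndpointApprox D a b → d₀ ∈ frontier D.carrier → d₀ ≠ D.pt 0 → d₀ ≠ D.pt 1 → Filter.Tendsto (fun δ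 => Literature.Probability.LatticeModels.meshPoint δ (d δ)) (nhdsWithin 0 (Set.Ioi 0)) (nhds d₀) → (∀ᶠ δ in nhdsWithin 0 (Set.Ioi 0), (Literature.Probability.LatticeModels.discreteDomainGraph D.carrier δ).Reachable (a δ) (d δ)) → ∀ ρ ε : ℝ, 0 < ρ → 0 < ε → ∀ᶠ δ in nhdsWithin 0 (Set.Ioi 0), ∃ C : ℝ, Literature.Probability.RandomPlanarGeometry.SAW.law D.carrier δ (a δ) (b δ) {γ | ∃ (w : Literature.Probability.LatticeModels.Site 2) (hw : w ∈ γ.walk.support), (∀ v ∈ (γ.walk.takeUntil w hw).support, ρ ≤ dist (Literature.Probability.LatticeModels.meshPoint δ v) (D.pt 1) ∧ ρ ≤ dist (Literature.Probability.LatticeModels.meshPoint δ v) d₀) ∧ 0 < Z δ w (γ.walk.takeUntil w hw).support (d δ) ∧ ε < |Real.log (Z δ w (γ.walk.takeUntil w hw).support (d δ) / Z δ w (γ.walk.takeUntil w hw).support (b δ)) - (5 / 8) * Real.log (H δ w (γ.walk.takeUntil w hw).support (d δ) / H δ w (γ.walk.takeUntil w hw).support (b δ)) - C|} ≤ ENNReal.ofReal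 ε

/-- item stmt-CriticalPhenomena-4481 · crux · rank 3 · open · by planner
why it might fail: Its only known engine is Condition G2 (uniform unforced-annulus-crossing bound over all conditionings), for which no SAW technology exists (KS17 §4: FK, percolation, harmonic explorer, LERW; G2 even FAILS for UST §4.5); limits could a priori have boundary-creeping pieces not generated by a curve.
sources: KemppainenSmirnov2017, DuminilCopinHammond2013, arXiv:2310.17299, LawlerSchrammWerner2004SAW
[crux] (Kemppainen–Smirnov regularity for the SAW) for every Dobrushin domain, endpoint
approximation and chordal uniformizing map φ, every probability subsequential limit law ν of the SAW
curve laws (`IsSubseqLimitLaw`) is carried by curve classes that start at a and are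
Loewner-describable through φ (`IsLoewnerDescribable`: capacity-parametrised pull-back generated by
a curve with continuous driving function) — KS17 Thm 1.5 (ii) / Cor 1.7 in output form, the
hypothesis shape of HarmonicPassage / HarmonicIdentification. [difficulty: open-problem] -/
@[route_item "route-CriticalPhenomena-SAWLaplacianWalk", crux]
def LimitsDescribable : Prop :=
  ∀ (D : Literature.Probability.RandomPlanarGeometry.DobrushinDomain) (a b : ℝ → Literature.Probability.LatticeModels.Site 2), Literature.Probability.RandomPlanarGeometry.SAW.IsEndpointApprox D a b → ∀ (φ : Literature.Probability.RandomPlanarGeometry.ConformalEquiv UpperHalfPlane.upperHalfPlaneSet D.carrier), D.IsChordalUniformizing φ → ∀ ν : MeasureTheory.Measure (Literature.Probability.RandomPlanarGeometry.CurveClass ℂ), MeasureTheory.IsProbabilityMeasure ν → Literature.Probability.RandomPlanarGeometry.IsSubseqLimitLaw (fun δ (γ : Literature.Probability.RandomPlanarGeometry.SAW.DomainSAW D.carrier δ (a δ) (b δ)) => γ.curve) (fun δ => Literature.Probability.RandomPlanarGeometry.SAW.law D.carrier δ (a δ) (b δ)) ν → ∀ᵐ c ∂ν, Literature.Probability.RandomPlanarGeometry.IsLoewnerDescribable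 φ c ∧ c.source = D.pt 0

/-- item stmt-CriticalPhenomena-4482 · crux · rank 4 · open · by planner
why it might fail: Needs SRW hitting ratios AT THE TIP of a rough lattice slit to converge to the continuum tip kernel uniformly along SAW pasts (boundary Harnack at a fractal tip; leakage through width-δ channels) plus uniform integrability of the density martingale; either may fail on atypical pasts.
sources: KozdronLawler2005, Chelkak2016, YadinYehudayoff2011, LawlerSchrammWerner2004, CDHKSCRAS2014
[crux] TipHarmonicLaw ⇒ for every (Ω; a, b), endpoint approximation, third point d₀ with
approximations d_δ, chordal uniformizing map φ with boundary value d₀ at the real point x, and every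
probability subsequential limit ν of the SAW curve laws that is carried by Loewner-describable
curves from a: for all levels m and times s ≤ t, E_ν[(N^{x,m}_t − N^{x,m}_s)·ψ(W_{s₁}, …, W_{sₙ})] =
0 for continuous |ψ| ≤ 1 and sᵢ ≤ s, where W = drivingFunction φ, N^x_t = exp(−(5/4)∫₀ᵗ du/(g_u(x) −
W_u)²)·|g_t(x) − W_t|^{−5/4} (= [g_t′(x)/(g_t(x) − W_t)²]^{5/8}) and N^{x,m} is N^x stopped when
|g(x) − W| ≤ 1/(m+1) or at time m+1. [deps: TipHarmonicLaw] [difficulty: XL] -/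
@[route_item "route-CriticalPhenomena-SAWLaplacianWalk", crux]
def HarmonicPassage : Prop :=
  TipHarmonicLaw → ∀ (D : Literature.Probability.RandomPlanarGeometry.DobrushinDomain) (a b d : ℝ → Literature.Probability.LatticeModels.Site 2) (d₀ : ℂ) (φ : Literature.Probability.RandomPlanarGeometry.ConformalEquiv UpperHalfPlane.upperHalfPlaneSet D.carrier) (x : ℝ) (ν : MeasureTheory.Measure (Literature.Probability.RandomPlanarGeometry.CurveClass ℂ)), let W : Literature.Probability.RandomPlanarGeometry.CurveClass ℂ → NNReal → ℝ := fun c => Literature.Probability.RandomPlanarGeometry.drivingFunction φ c; let gap : ℝ → NNReal → Literature.Probability.RandomPlanarGeometry.CurveClass ℂ → ℝ := fun x t c => (Literature.Probability.RandomPlanarGeometry.Loewner.map (W c) t (x : ℂ)).re - W c t; let N : ℝ → NNReal → Literature.Probability.RandomPlanarGeometry.CurveClass ℂ → ℝ := fun x t c => Real.exp (-(5 / 4 : ℝ) * ∫ s in (0 : ℝ)..(t : ℝ), 1 / (gap x s.toNNReal c) ^ 2) * |gap x t c| ^ (-(5 / 4 : ℝ)); let τ : ℝ → ℕ → Literature.Probability.RandomPlanarGeometry.CurveClass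 ℂ → NNReal := fun x m c => sInf ({t : NNReal | |gap x t c| ≤ 1 / ((m : ℝ) + 1)} ∪ {(m : NNReal) + 1}); Literature.Probability.RandomPlanarGeometry.SAW.IsEndpointApprox D a b → d₀ ∈ frontier D.carrier → d₀ ≠ D.pt 0 → d₀ ≠ D.pt 1 → Filter.Tendsto (fun δ => Literature.Probability.LatticeModels.meshPoint δ (d δ)) (nhdsWithin 0 (Set.Ioi 0)) (nhds d₀) → (∀ᶠ δ in nhdsWithin 0 (Set.Ioi 0), (Literature.Probability.LatticeModels.discreteDomainGraph D.carrier δ).Reachable (a δ) (d δ)) → D.IsChordalUniformizing φ → φ.HasBoundaryValue (x : ℂ) d₀ → MeasureTheory.IsProbabilityMeasure ν → Literature.Probability.RandomPlanarGeometry.IsSubseqLimitLaw (fun δ (γ : Literature.Probability.RandomPlanarGeometry.SAW.DomainSAW D.carrier δ (a δ) (b δ)) => γ.curve) (fun δ => Literature.Probability.RandomPlanarGeometry.SAW.law D.carrier δ (a δ) (b δ)) ν → (∀ᵐ c ∂ν, Literature.Probability.RandomPlanarGeometry.IsLoewnerDescribable φ c ∧ c.source = D.pt 0) → ∀ (m :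 ℕ) (s t : NNReal), s ≤ t → ∀ (n : ℕ) (S : Fin n → NNReal), (∀ k, S k ≤ s) → ∀ ψ : (Fin n → ℝ) → ℝ, Continuous ψ → (∀ v, |ψ v| ≤ 1) → ∫ c, (N x (min t (τ x m c)) c - N x (min s (τ x m c)) c) * ψ (fun k => W c (S k)) ∂ν = 0

/-- item stmt-CriticalPhenomena-4483 · crux · rank 5 · open · by planner
why it might fail: As typed, c ↦ N^{x,m}_t(c) must be measurable/integrable (else the Bochner junk value 0 makes the hypothesis vacuous and the statement false); a one-sided far field (|x| → ∞ along T) has to suffice; W 0 = 0 must be derived from source = a and boundary injectivity.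
sources: CDHKSCRAS2014, LawlerSchrammWerner2003, Lawler2006, arXiv:math/0505368
[crux] let φ be a chordal uniformizing map of (D; a, b), ν a probability law on curve classes,
ν-a.e. Loewner-describable through φ and starting at a; if for an unbounded (above or below) set T
of reals x the stopped harmonic 5/8-observables N^{x,m} of W = drivingFunction φ satisfy the
cylinder identity for all m, s ≤ t, ψ, then ν is the chordal SLE_{8/3} law (`IsSLELaw (8/3) D ν`).
Proof route: monotone class ⇒ N^{x,m} bounded martingales; far-field stopping of W; x^{5/4}N^x_t = 1
+ (5/4)W_t/x + (45/32)(W_t² − (8/3)t)/x² + O(x^{−3}) ⇒ W and W² − (8/3)t continuous local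
martingales ⇒ Lévy ⇒ `isSLELaw_of_isLocalMartingale_driving`. [difficulty: L] -/
@[route_item "route-CriticalPhenomena-SAWLaplacianWalk", crux]
def HarmonicIdentification : Prop :=
  ∀ (D : Literature.Probability.RandomPlanarGeometry.DobrushinDomain) (φ : Literature.Probability.RandomPlanarGeometry.ConformalEquiv UpperHalfPlane.upperHalfPlaneSet D.carrier) (ν : MeasureTheory.Measure (Literature.Probability.RandomPlanarGeometry.CurveClass ℂ)) (T : Set ℝ), let W : Literature.Probability.RandomPlanarGeometry.CurveClass ℂ → NNReal → ℝ := fun c => Literature.Probability.RandomPlanarGeometry.drivingFunction φ c; let gap : ℝ → NNReal → Literature.Probability.RandomPlanarGeometry.CurveClass ℂ → ℝ := fun x t c => (Literature.Probability.RandomPlanarGeometry.Loewner.map (W c) t (x : ℂ)).re - W c t; let N : ℝ → NNReal → Literature.Probability.RandomPlanarGeometry.CurveClass ℂ → ℝ := fun x t c => Real.exp (-(5 / 4 : ℝ) * ∫ s in (0 : ℝ)..(t : ℝ), 1 / (gap x s.toNNReal c) ^ 2) * |gap x t c| ^ (-(5 / 4 : ℝ)); let τ : ℝ → ℕ → Literature.Probability.RandomPlanarGeometry.CurveClass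 ℂ → NNReal := fun x m c => sInf ({t : NNReal | |gap x t c| ≤ 1 / ((m : ℝ) + 1)} ∪ {(m : NNReal) + 1}); D.IsChordalUniformizing φ → MeasureTheory.IsProbabilityMeasure ν → (∀ᵐ c ∂ν, Literature.Probability.RandomPlanarGeometry.IsLoewnerDescribable φ c ∧ c.source = D.pt 0) → ¬ (BddAbove T ∧ BddBelow T) → (∀ x ∈ T, ∀ (m : ℕ) (s t : NNReal), s ≤ t → ∀ (n : ℕ) (S : Fin n → NNReal), (∀ k, S k ≤ s) → ∀ ψ : (Fin n → ℝ) → ℝ, Continuous ψ → (∀ v, |ψ v| ≤ 1) → ∫ c, (N x (min t (τ x m c)) c - N x (min s (τ x m c)) c) * ψ (fun k => W c (S k)) ∂ν = 0) → Literature.Probability.RandomPlanarGeometry.IsSLELaw ((8 : NNReal) / 3) D ν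

/-- item stmt-CriticalPhenomena-1881 · crux · rank 6 · open · by planner
why it might fail: No annulus-crossing / traversal bound for the critical SAW is in print (Aizenman–Burchard input missing; KS17 §4 omits SAW); sub-ballisticity (DuminilCopinHammond2013, arXiv:2310.17299) is the strongest known input; boundary approach of the x_c-SAW is uncontrolled.
sources: KemppainenSmirnov2017, DuminilCopinHammond2013, arXiv:2310.17299, Summit.CriticalPhenomena.SAWScalingLimit.Theorems.SAWParafermionTight_refuted
[support] EVENTUAL TIGHTNESS of the critical SAW laws: for every Dobrushin domain and endpoint
approximation, IsTightAlongMesh (fun δ γ => γ.curve) (fun δ => SAW.law D δ a_δ b_δ) — for every ε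
some compact set of CurveClass ℂ carries all but ε of the mass for all small δ. This is the form the
Prokhorov criterion convergesInLawToSLE_of_isTightAlongMesh consumes and the repair of the refuted
all-δ Tight (IsTightLaws over δ ∈ (0,1]) suggested by the refuting theorem; offered to routes
SAWParafermion / SAWConfRestriction as their restated r3/r4. -/
@[route_item "route-CriticalPhenomena-SAWLaplacianWalk", crux]
def EventualTight : Prop :=
  ∀ (D : Literature.Probability.RandomPlanarGeometry.DobrushinDomain) (a b : ℝ → Literature.Probability.LatticeModels.Site 2), Literature.Probability.RandomPlanarGeometry.SAW.IsEndpointApprox D a b → Literature.Probability.RandomPlanarGeometry.IsTightAlongMesh (fun δ (γ : Literature.Probability.RandomPlanarGeometry.SAW.DomainSAW D.carrier δ (a δ) (b δ)) => γ.curve) (fun δ => Literature.Probability.RandomPlanarGeometry.SAW.law D.carrier δ (a δ) (b δ))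

/-- item stmt-CriticalPhenomena-4484 · support · rank 9 · closed · proved by Summit.CriticalPhenomena.SAWScalingLimit.Theorems.SlitFirstStep_proof @ cda6590f3b32 (prover) · by planner
sources: Lawler2005ConformallyInvariant, MadrasSlade1993
[support] first-step decomposition of the slit partition function: for a bounded Ω, δ > 0, w ∈ S and
w ≠ c, Z_{w,S}(c) = x_c · Σ_{u ∼ w, u ∉ S} Z_{u, u::S}(c) — the identity that makes M_n =
Z_η(d)/Z_η(b) an exact martingale (Lawler 2005, (0.1) with the harmonic q replaced by SAW masses
q*). [difficulty: provable-now] -/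
@[route_item "route-CriticalPhenomena-SAWLaplacianWalk"]
def SlitFirstStep : Prop :=
  ∀ (Ω : Set ℂ) (δ : ℝ) (w c : Literature.Probability.LatticeModels.Site 2) (S : List (Literature.Probability.LatticeModels.Site 2)), let Z : Literature.Probability.LatticeModels.Site 2 → List (Literature.Probability.LatticeModels.Site 2) → ℝ := fun u S' => ∑' ω : Literature.Probability.RandomPlanarGeometry.SAW.DomainSAW Ω δ u c, if ∀ v ∈ ω.walk.support.tail, v ∉ S' then Literature.Probability.RandomPlanarGeometry.SAW.criticalFugacity ^ ω.length else 0; Bornology.IsBounded Ω → 0 < δ → w ∈ S → w ≠ c → Z w S = Literature.Probability.RandomPlanarGeometry.SAW.criticalFugacity * ∑ᶠ u ∈ {u | (Literature.Probability.LatticeModels.discreteDomainGraph Ω δ).Adj w u ∧ u ∉ S}, Z u (u :: S)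

/-- item stmt-CriticalPhenomena-4485 · support · rank 9 · open · by planner
sources: Lawler2005ConformallyInvariant, KennedyLawler2013, Lawler2006
[support] (leading order of K58; "the polymer's next step does not know its distant target") with
SAW.law-probability → 1, simultaneously at all steps before coming ρ-close to b or d₀, ONE lattice
step changes log(Z_η(d_δ)/Z_η(b_δ)) by at most ε — equivalently the one-step kernels of the SAW
aimed at b and aimed at d agree up to e^{±ε}; implied by TipHarmonicLaw and random-walk boundary
Harnack, of independent interest (ratio mixing for the critical SAW). [difficulty: open-problem] -/
@[route_item "route-CriticalPhenomena-SAWLaplacianWalk"]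
def TipForgetsTarget : Prop :=
  ∀ (D : Literature.Probability.RandomPlanarGeometry.DobrushinDomain) (a b d : ℝ → Literature.Probability.LatticeModels.Site 2) (d₀ : ℂ), let Z : ℝ → Literature.Probability.LatticeModels.Site 2 → List (Literature.Probability.LatticeModels.Site 2) → Literature.Probability.LatticeModels.Site 2 → ℝ := fun δ w S c => ∑' ω : Literature.Probability.RandomPlanarGeometry.SAW.DomainSAW D.carrier δ w c, if ∀ v ∈ ω.walk.support.tail, v ∉ S then Literature.Probability.RandomPlanarGeometry.SAW.criticalFugacity ^ ω.length else 0; Literature.Probability.RandomPlanarGeometry.SAW.IsEndpointApprox D a b → d₀ ∈ frontier D.carrier → d₀ ≠ D.pt 0 → d₀ ≠ D.pt 1 → Filter.Tendsto (fun δ => Literature.Probability.LatticeModels.meshPoint δ (d δ)) (nhdsWithin 0 (Set.Ioi 0)) (nhds d₀) → (∀ᶠ δ in nhdsWithin 0 (Set.Ioi 0), (Literature.Probability.LatticeModels.discreteDomainGraph D.carrier δ).Reachable (a δ) (d δ)) → ∀ ρ ε : ℝ, 0 < ρ → 0 < ε → ∀ᶠ δ in nhdsWithin 0 (Set.Ioi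 0), Literature.Probability.RandomPlanarGeometry.SAW.law D.carrier δ (a δ) (b δ) {γ | ∃ (w w' : Literature.Probability.LatticeModels.Site 2) (hw : w ∈ γ.walk.support) (hw' : w' ∈ γ.walk.support), (γ.walk.takeUntil w' hw').length = (γ.walk.takeUntil w hw).length + 1 ∧ (∀ v ∈ (γ.walk.takeUntil w' hw').support, ρ ≤ dist (Literature.Probability.LatticeModels.meshPoint δ v) (D.pt 1) ∧ ρ ≤ dist (Literature.Probability.LatticeModels.meshPoint δ v) d₀) ∧ 0 < Z δ w' (γ.walk.takeUntil w' hw').support (d δ) ∧ ε < |Real.log (Z δ w' (γ.walk.takeUntil w' hw').support (d δ) / Z δ w' (γ.walk.takeUntil w' hw').support (b δ)) - Real.log (Z δ w (γ.walk.takeUntil w hw).support (d δ) / Z δ w (γ.walk.takeUntil w hw).support (b δ))|} ≤ ENNReal.ofReal ε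

/-- item stmt-CriticalPhenomena-4486 · support · rank 9 · closed · proved by Summit.CriticalPhenomena.SAWScalingLimit.Theorems.boundaryApprox_proof (prover) · by planner
sources: ChelkakSmirnov2012, DuminilCopinSmirnov2012
[support] every boundary point d₀ of a Dobrushin domain with an endpoint approximation admits
lattice approximations d_δ → d₀ joined to a_δ in Ω_δ for all small δ (the largest component of δℤ² ∩
Ω exhausts Ω); supplies the unbounded set of third marked points x = φ⁻¹(d₀) that the assembly feeds
to HarmonicIdentification. [difficulty: M] -/
@[route_item "route-CriticalPhenomena-SAWLaplacianWalk", crux]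
def BoundaryApprox : Prop :=
  ∀ (D : Literature.Probability.RandomPlanarGeometry.DobrushinDomain) (a b : ℝ → Literature.Probability.LatticeModels.Site 2), Literature.Probability.RandomPlanarGeometry.SAW.IsEndpointApprox D a b → ∀ d₀ ∈ frontier D.carrier, ∃ d : ℝ → Literature.Probability.LatticeModels.Site 2, Filter.Tendsto (fun δ => Literature.Probability.LatticeModels.meshPoint δ (d δ)) (nhdsWithin 0 (Set.Ioi 0)) (nhds d₀) ∧ ∀ᶠ δ in nhdsWithin 0 (Set.Ioi 0), (Literature.Probability.LatticeModels.discreteDomainGraph D.carrier δ).Reachable (a δ) (d δ)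

/-- item stmt-CriticalPhenomena-4487 · assembly · rank 1 · closed · proved by Summit.CriticalPhenomena.SAWScalingLimit.Theorems.laplacianWalk_assembly_proof (prover) · by planner
sources: KemppainenSmirnov2017, CDHKSCRAS2014, LawlerSchrammWerner2004SAW
[assembly] BoundaryApprox → TipHarmonicLaw → HarmonicPassage → HarmonicIdentification →
LimitsDescribable → EventualTight → SAWScalingLimit. -/
@[route_item "route-CriticalPhenomena-SAWLaplacianWalk"]
def Assembly : Prop :=
  BoundaryApprox → TipHarmonicLaw → HarmonicPassage → HarmonicIdentification → LimitsDescribable → EventualTight → SAWScalingLimit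

/-! D-0027 §2.1 — DECIDING THEOREM (planner-authored via `route open/edit --closes-file`; by planner-rbadge-CriticalPhenomena-SAWLaplacianW-94ddb216-g4-0 2026-08-15T16:26:27Z):
its hypotheses are this route's items and its conclusion the sub-problem Statement (glue_lint), and it elaborates with this file. -/

@[closes "route-CriticalPhenomena-SAWLaplacianWalk"] theorem closes (hB : BoundaryApprox) (hK : TipHarmonicLaw) (hP : HarmonicPassage)
    (hI : HarmonicIdentification) (hR : LimitsDescribable) (hT : EventualTight) :
    _root_.SAWScalingLimit :=
  by
  intro D a b hab
  classical
  -- Step 1: for small δ the SAW law is a probability measure (x_c > 0, finitely many SAWs, one exists)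
  have hxc : 0 < Literature.Probability.RandomPlanarGeometry.SAW.criticalFugacity := Literature.Probability.RandomPlanarGeometry.SAW.criticalFugacity_pos_lt_one'.1
  have hprob : ∀ᶠ δ in 𝓝[>] (0 : ℝ), IsProbabilityMeasure (Literature.Probability.RandomPlanarGeometry.SAW.law D.carrier δ (a δ) (b δ)) := by
    filter_upwards [hab.reachable, self_mem_nhdsWithin] with δ hreach hδ
    have hδ : (0 : ℝ) < δ := hδ
    -- finiteness of the set of SAWs
    haveI hfin : Finite (Literature.Probability.RandomPlanarGeometry.SAW.DomainSAW D.carrier δ (a δ) (b δ)) := by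
      let S : Set (Literature.Probability.LatticeModels.Site 2) := Literature.Probability.LatticeModels.meshDomain D.carrier δ ∪ {a δ}
      have hSfin : S.Finite := (Literature.Probability.LatticeModels.meshDomain_finite D.isBounded hδ).union (Set.finite_singleton _)
      haveI : Fintype ↥S := hSfin.fintype
      have hsupp : ∀ γ : Literature.Probability.RandomPlanarGeometry.SAW.DomainSAW D.carrier δ (a δ) (b δ), ∀ w ∈ γ.walk.support, w ∈ S := by
        intro γ
        have key : ∀ {u v : Literature.Probability.LatticeModels.Site 2} (p : (Literature.Probability.LatticeModels.discreteDomainGraph D.carrier δ).Walk u v),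
            u ∈ S → ∀ w ∈ p.support, w ∈ S := by
          intro u v p
          induction p with
          | nil =>
            intro hu w hw
            rw [SimpleGraph.Walk.support_nil, List.mem_singleton] at hw
            exact hw ▸ hu
          | cons h p ih =>
            intro hu w hw
            rw [SimpleGraph.Walk.support_cons, List.mem_cons] at hw
            rcases hw with rfl | hw
            · exact hu
            · exact ih (Or.inl (Literature.Probability.LatticeModels.discreteDomainGraph_adj_iff.1 h).2.2) w hw
        exact key γ.walk (Or.inr rfl)
      let F : Literature.Probability.RandomPlanarGeometry.SAW.DomainSAW D.carrier δ (a δ) (b δ) → {l : List ↥S // l.length ≤ Fintype.card ↥S} :=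
        fun γ => ⟨γ.walk.support.pmap (fun w hw => ⟨w, hw⟩) (hsupp γ), by
          rw [List.length_pmap]
          have hnd : (γ.walk.support.pmap (fun w hw => (⟨w, hw⟩ : ↥S)) (hsupp γ)).Nodup :=
            List.Nodup.pmap (fun _ _ _ _ h => congrArg Subtype.val h) γ.isPath.support_nodup
          have := hnd.length_le_card
          rwa [List.length_pmap] at this⟩
      haveI : Finite {l : List ↥S // l.length ≤ Fintype.card ↥S} :=
        (List.finite_length_le _ _).to_subtype
      refine Finite.of_injective F fun γ γ' h => ?_
      have h' := congrArg (fun l : {l : List ↥S // l.length ≤ Fintype.card ↥S} => l.1.map Subtype.val) h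
      obtain ⟨p, hp⟩ := γ
      obtain ⟨p', hp'⟩ := γ'
      have hs : p.support = p'.support := by simpa [F, List.map_pmap] using h'
      cases SimpleGraph.Walk.support_injective hs
      rfl
    haveI := Fintype.ofFinite (Literature.Probability.RandomPlanarGeometry.SAW.DomainSAW D.carrier δ (a δ) (b δ))
    -- the partition function is finite …
    have htop : Literature.Probability.RandomPlanarGeometry.SAW.weight D.carrier δ (a δ) (b δ) Set.univ ≠ ⊤ := by
      rw [Literature.Probability.RandomPlanarGeometry.SAW.weight, Measure.sum_apply _ MeasurableSet.univ, tsum_fintype]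
      refine (ENNReal.sum_lt_top.2 fun γ _ => ?_).ne
      rw [Measure.smul_apply, smul_eq_mul]
      exact ENNReal.mul_lt_top ENNReal.ofReal_lt_top (measure_lt_top _ _)
    -- … and positive
    rcases hreach with ⟨p⟩
    let γ₀ : Literature.Probability.RandomPlanarGeometry.SAW.DomainSAW D.carrier δ (a δ) (b δ) := ⟨p.bypass, p.bypass_isPath⟩
    have h0 : Literature.Probability.RandomPlanarGeometry.SAW.weight D.carrier δ (a δ) (b δ) Set.univ ≠ 0 := by
      intro h
      have h1 : Literature.Probability.RandomPlanarGeometry.SAW.weight D.carrier δ (a δ) (b δ) {γ₀} = 0 :=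
        measure_mono_null (Set.subset_univ _) h
      rw [Literature.Probability.RandomPlanarGeometry.SAW.weight_singleton, ENNReal.ofReal_eq_zero] at h1
      exact absurd h1 (not_le.2 (pow_pos hxc _))
    exact ⟨by rw [Literature.Probability.RandomPlanarGeometry.SAW.law, Measure.smul_apply, smul_eq_mul, ENNReal.inv_mul_cancel h0 htop]⟩
  -- Step 2: pad the image laws to probability measures at every mesh (unchanged near 0⁺)
  let c₀ : Literature.Probability.RandomPlanarGeometry.CurveClass ℂ := (Literature.Probability.RandomPlanarGeometry.SAW.DomainSAW.nil (Ω := D.carrier) (δ := 1) (a 1)).curve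
  let Q : ℝ → Measure (Literature.Probability.RandomPlanarGeometry.CurveClass ℂ) := fun δ =>
    if IsProbabilityMeasure (Literature.Probability.RandomPlanarGeometry.SAW.law D.carrier δ (a δ) (b δ)) then
      (Literature.Probability.RandomPlanarGeometry.SAW.law D.carrier δ (a δ) (b δ)).map (fun γ => γ.curve) else Measure.dirac c₀
  have hQprob : ∀ δ, IsProbabilityMeasure (Q δ) := by
    intro δ
    by_cases h : IsProbabilityMeasure (Literature.Probability.RandomPlanarGeometry.SAW.law D.carrier δ (a δ) (b δ))
    · dsimp only [Q]
      rw [if_pos h]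
      exact Measure.isProbabilityMeasure_map (Literature.Probability.RandomPlanarGeometry.SAW.aemeasurable_curve _ _ _ _)
    · dsimp only [Q]
      rw [if_neg h]
      infer_instance
  have hQeq : ∀ᶠ δ in 𝓝[>] (0 : ℝ),
      Q δ = (Literature.Probability.RandomPlanarGeometry.SAW.law D.carrier δ (a δ) (b δ)).map (fun γ => γ.curve) :=
    hprob.mono fun δ h => if_pos h
  have hQint : ∀ᶠ δ in 𝓝[>] (0 : ℝ), ∀ f : BoundedContinuousFunction (Literature.Probability.RandomPlanarGeometry.CurveClass ℂ) ℝ,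
      ∫ x, f x ∂(Q δ) = ∫ γ, f γ.curve ∂(Literature.Probability.RandomPlanarGeometry.SAW.law D.carrier δ (a δ) (b δ)) :=
    hQeq.mono fun δ h f => by
      rw [h]
      exact integral_map (Literature.Probability.RandomPlanarGeometry.SAW.aemeasurable_curve _ _ _ _) f.continuous.aestronglyMeasurable
  -- subsequential limits of the padded family are subsequential limits of the SAW curve laws
  have hsubseq : ∀ μ : Measure (Literature.Probability.RandomPlanarGeometry.CurveClass ℂ),
      Literature.Probability.RandomPlanarGeometry.IsSubseqLimitLaw (Ωδ := fun _ : ℝ => Literature.Probability.RandomPlanarGeometry.CurveClass ℂ) (fun _ => id) Q μ →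
        Literature.Probability.RandomPlanarGeometry.IsSubseqLimitLaw (fun δ (γ : Literature.Probability.RandomPlanarGeometry.SAW.DomainSAW D.carrier δ (a δ) (b δ)) => γ.curve)
          (fun δ => Literature.Probability.RandomPlanarGeometry.SAW.law D.carrier δ (a δ) (b δ)) μ := by
    rintro μ ⟨s, hs, hlim⟩
    refine ⟨s, hs, fun f => ?_⟩
    have hev : (fun n => ∫ ω, f ((fun _ : ℝ => (id : Literature.Probability.RandomPlanarGeometry.CurveClass ℂ → Literature.Probability.RandomPlanarGeometry.CurveClass ℂ)) (s n) ω) ∂Q (s n))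
        =ᶠ[atTop] fun n => ∫ γ, f γ.curve ∂(Literature.Probability.RandomPlanarGeometry.SAW.law D.carrier (s n) (a (s n)) (b (s n))) := by
      filter_upwards [hs.eventually hQint] with n hn
      exact hn f
    exact (hlim f).congr' hev
  -- Step 3: every probability subsequential limit is chordal SLE(8/3): uniformizer φ, Carathéodory
  -- disc extension, third marked points φ(x) (x ≠ 0), BoundaryApprox, HarmonicPassage, HarmonicIdentification
  have hident : ∀ μ : Measure (Literature.Probability.RandomPlanarGeometry.CurveClass ℂ), IsProbabilityMeasure μ →
      Literature.Probability.RandomPlanarGeometry.IsSubseqLimitLaw (fun δ (γ : Literature.Probability.RandomPlanarGeometry.SAW.DomainSAW D.carrier δ (a δ) (b δ)) => γ.curve)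
        (fun δ => Literature.Probability.RandomPlanarGeometry.SAW.law D.carrier δ (a δ) (b δ)) μ → Literature.Probability.RandomPlanarGeometry.IsSLELaw ((8 : NNReal) / 3) D μ := by
    intro μ hμ hsub
    obtain ⟨φ, hφ⟩ := Literature.Probability.RandomPlanarGeometry.MarkedDomain.exists_isChordalUniformizing_holds D
    obtain ⟨Φ, hΦ⟩ :=
      Literature.Probability.RandomPlanarGeometry.JordanDomain.exists_isDiscExtension Literature.Probability.RandomPlanarGeometry.JordanDomain.exists_continuousOn_extension_holds φ
    have hdesc := hR D a b hab φ hφ μ hμ hsub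
    refine hI D φ μ {x : ℝ | x ≠ 0} hφ hμ hdesc ?_ ?_
    · rintro ⟨⟨M, hM⟩, -⟩
      have h1 : |M| + 1 ∈ {x : ℝ | x ≠ 0} := by
        simp only [ne_eq, Set.mem_setOf_eq]
        positivity
      have h2 := hM h1
      linarith [le_abs_self M]
    · intro x hx m s t hst n S hS ψ hψc hψb
      have hx' : x ≠ 0 := hx
      -- the third marked boundary point `d₀ = φ(x)`
      have hd₀mem : φ.boundaryExtension (x : ℂ) ∈ frontier D.carrier :=
        hΦ.boundaryExtension_ofReal_mem_frontier x
      have hd₀b : φ.boundaryExtension (x : ℂ) ≠ D.pt 1 := by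
        rw [← hΦ.apply_one_eq hφ.2]
        exact hΦ.boundaryExtension_ofReal_ne x
      have hd₀a : φ.boundaryExtension (x : ℂ) ≠ D.pt 0 := by
        intro heq
        obtain ⟨t, -, ht⟩ := Literature.Probability.RandomPlanarGeometry.JordanDomain.exists_mem_Ico_boundary_eq D.toJordanDomain hd₀mem 0
        have hx1 : Literature.Probability.RandomPlanarGeometry.JordanDomain.discParam D.toJordanDomain Φ t = x := hΦ.discParam_eq ht
        have h0 : φ.boundaryExtension ((0 : ℝ) : ℂ) = D.pt 0 := by
          rw [Complex.ofReal_zero]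
          exact Literature.Probability.RandomPlanarGeometry.JordanDomain.boundaryExtension_eq_of_hasBoundaryValue' φ (by simp) hφ.1
        have hx0 : Literature.Probability.RandomPlanarGeometry.JordanDomain.discParam D.toJordanDomain Φ t = 0 :=
          hΦ.discParam_eq (ht.trans (heq.trans h0.symm))
        exact hx' (hx1.symm.trans hx0)
      have hbv : φ.HasBoundaryValue (x : ℂ) (φ.boundaryExtension (x : ℂ)) :=
        hΦ.tendsto_nhdsWithin (by simp)
      obtain ⟨d, hdt, hdr⟩ := hB D a b hab _ hd₀mem
      exact hP hK D a b d _ φ x μ hab hd₀mem hd₀a hd₀b hdt hdr hφ hbv hμ hsub hdesc m s t hst n S hS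
        ψ hψc hψb
  -- the criterion, for the padded family
  have hconv : Literature.Probability.RandomPlanarGeometry.ConvergesInLawToSLE ((8 : NNReal) / 3) D
      (Ωδ := fun _ : ℝ => Literature.Probability.RandomPlanarGeometry.CurveClass ℂ) (fun _ => id) Q := by
    haveI : ∀ δ, IsProbabilityMeasure (Q δ) := hQprob
    refine Literature.Probability.RandomPlanarGeometry.convergesInLawToSLE_of_isTightAlongMesh' (Eventually.of_forall fun δ => aemeasurable_id)
      ?_ (fun μ hμ hsub => hident μ hμ (hsubseq μ hsub))
    intro ε hε
    obtain ⟨K, hK, hev⟩ := hT D a b hab ε hε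
    have hmeas : MeasurableSet Kᶜ := hK.isClosed.isOpen_compl.measurableSet
    refine ⟨K, hK, ?_⟩
    filter_upwards [hev, hQeq] with δ hδ hq
    change Q δ Kᶜ ≤ ε
    rw [hq, Measure.map_apply (Literature.Probability.RandomPlanarGeometry.SAW.DomainSAW.measurable_of_top _) hmeas]
    exact hδ
  -- Step 4: Prokhorov criterion for the padded family, then undo the padding
  obtain ⟨Γ, hΓ, -, hlaw⟩ := hconv
  refine ⟨Γ, hΓ, Eventually.of_forall fun δ => Literature.Probability.RandomPlanarGeometry.SAW.aemeasurable_curve _ _ _ _, fun f => ?_⟩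
  have hev : (fun δ => ∫ ω, f ((fun _ : ℝ => (id : Literature.Probability.RandomPlanarGeometry.CurveClass ℂ → Literature.Probability.RandomPlanarGeometry.CurveClass ℂ)) δ ω) ∂Q δ)
      =ᶠ[𝓝[>] (0 : ℝ)] fun δ => ∫ γ, f γ.curve ∂(Literature.Probability.RandomPlanarGeometry.SAW.law D.carrier δ (a δ) (b δ)) :=
    hQint.mono fun δ h => h f
  exact (hlaw f).congr' hev

end Summit.CriticalPhenomena.SAWScalingLimit.Theses.SAWLaplacianWalk
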